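import Literature.Analysis.FluidPDE.JiaSverak2014LocalisedData
import Literature.Analysis.FluidPDE.NSSliceTimeIncrement
import HarnessLib

/-!
# Jia–Šverák 2014, local higher regularity: the time pairings of the solution near `t = 0`

Analysis/FluidPDE proofs file (theorems only; no definitions, no named facts), part of the proof
of the named fact `Literature.Analysis.FluidPDE.jia_sverak_2014_local_higher_regularity`
(`JiaSverak2014LocalRegularity.lean`; H. Jia, V. Šverák, Invent. Math. 196 (2014) =
arXiv:1204.0529, §4 proof of Thm 4.1: `‖∂ₜ∂ₓ^α u‖_{L^∞(B_{1/8}(x₀)×[0,T₂])} ≤ C(α,u₀)`). The time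
derivative is read off the equation in the weak form with initial datum: testing the local Leray
solution `(u, p)` on `(0,T') × ℝ³` with `η(t) Φ(x)` (`Φ` a test field on `B(x₀, 7/24)`, `η` a
time test function on `(-∞, T_b')`) and the du Bois-Reymond lemma with datum give, for a.e.
`t < T_b'`,

  `∫ ⟪u(t), Φ⟫ = ∫ ⟪u₀, Φ⟫ + ∫₀ᵗ ∫ (⟪u, DΦ u⟫ + ⟪u, ΔΦ⟫ + (p - c) div Φ)(s) ds`

(`pairing_primitive`), where `c(t)` is the Kang–Miura–Tsai gauge of the pressure on
`B(x₀, 7/24)` and `|u| ≤ K_b` on `(0, T_b') × B(x₀, 7/12)`.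

* `integrable_pairing_integrand`, `integrable_remainder_integrand` — integrability of the tested
  integrands on `(0,T_b') × ℝ³`;
* `pairing_primitive` — the statement above.

## References

* H. Jia, V. Šverák, Invent. Math. 196 (2014) = arXiv:1204.0529, §4. Bib key `JiaSverak2014`.
* J. C. Robinson, J. L. Rodrigo, W. Sadowski, *The Three-Dimensional Navier–Stokes Equations*
  (2016), §3.1 (3.1) and Lemma 13.8. Bib key `RobinsonRodrigoSadowski2016`.
* H. Brezis, *Functional Analysis, Sobolev Spaces and PDE* (2011), Lemma 8.1. Bib key
  `Brezis2011`.
-/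

noncomputable section

open MeasureTheory TopologicalSpace Set Function Filter Metric
open _root_.Topology
open scoped ENNReal NNReal RealInnerProductSpace Laplacian ContDiff

namespace Literature.Analysis.FluidPDE

namespace JiaSverak2014

open Literature.Analysis.UnboundedOperators LemarieRieusset2016

/-- The pairing integrand `⟪u, Φ⟫` of a field bounded by `K_b` a.e. on `(0,T_b') × B(x₀,7/12)`
against a continuous `Φ` supported in `B̄(x₀, 7/24)` is integrable on `(0, T_b') × ℝ³`. [folklore] -/
theorem integrable_pairing_integrand {u : ℝ → (EuclideanSpace ℝ (Fin 3)) → (EuclideanSpace ℝ (Fin 3))}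
    {x₀ : EuclideanSpace ℝ (Fin 3)} {Tb' Kb : ℝ}
    (hum : AEStronglyMeasurable (uncurry u) (volume.restrict (Ioo 0 Tb' ×ˢ (univ : Set (EuclideanSpace ℝ (Fin 3))))))
    (hbd : ∀ᵐ z ∂(volume.restrict (Ioo 0 Tb' ×ˢ ball x₀ (7 / 12))), ‖u z.1 z.2‖ ≤ Kb)
    {Φ : (EuclideanSpace ℝ (Fin 3)) → (EuclideanSpace ℝ (Fin 3))} (hΦc : Continuous Φ)
    (hΦs : ∀ x, x ∉ closedBall x₀ (7 / 24) → Φ x = 0) :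
    Integrable (fun z : ℝ × EuclideanSpace ℝ (Fin 3) => ⟪u z.1 z.2, Φ z.2⟫)
      (((volume : Measure ℝ).restrict (Ioo 0 Tb')).prod (volume : Measure (EuclideanSpace ℝ (Fin 3)))) := by
  have hμ : ((volume : Measure ℝ).restrict (Ioo 0 Tb')).prod (volume : Measure (EuclideanSpace ℝ (Fin 3))) =
      volume.restrict (Ioo 0 Tb' ×ˢ (univ : Set (EuclideanSpace ℝ (Fin 3)))) := by
    rw [Measure.volume_eq_prod, ← Measure.prod_restrict, Measure.restrict_univ]
  rw [hμ]
  haveI : IsFiniteMeasure ((volume : Measure ℝ).restrict (Ioo 0 Tb')) := ⟨by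
    rw [Measure.restrict_apply_univ]; exact measure_Ioo_lt_top⟩
  have hΦcs : HasCompactSupport Φ := HasCompactSupport.of_support_subset_isCompact (isCompact_closedBall x₀ (7 / 24))
    fun x hx => by_contra fun h => hx (hΦs x h)
  have hΦi : Integrable (fun x => ‖Φ x‖) (volume : Measure (EuclideanSpace ℝ (Fin 3))) :=
    (hΦc.integrable_of_hasCompactSupport (μ := volume) hΦcs).norm
  have hdom : Integrable (fun z : ℝ × EuclideanSpace ℝ (Fin 3) => Kb * ‖Φ z.2‖)
      (volume.restrict (Ioo 0 Tb' ×ˢ (univ : Set (EuclideanSpace ℝ (Fin 3))))) := by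
    rw [← hμ]
    have h := (integrable_const Kb).mul_prod hΦi (μ := (volume : Measure ℝ).restrict (Ioo 0 Tb'))
    simpa using h
  refine Integrable.mono' hdom (hum.inner (hΦc.comp continuous_snd).aestronglyMeasurable) ?_
  have hbd' : ∀ᵐ z ∂(volume : Measure (ℝ × EuclideanSpace ℝ (Fin 3))), z ∈ Ioo 0 Tb' ×ˢ ball x₀ (7 / 12) → ‖u z.1 z.2‖ ≤ Kb :=
    (ae_restrict_iff' (measurableSet_Ioo.prod measurableSet_ball)).1 hbd
  rw [ae_restrict_iff' (measurableSet_Ioo.prod MeasurableSet.univ)]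
  filter_upwards [hbd'] with z hz hzS
  by_cases hx : z.2 ∈ closedBall x₀ (7 / 24)
  · have hxB : z.2 ∈ ball x₀ (7 / 12) := closedBall_subset_ball (by norm_num) hx
    calc ‖⟪u z.1 z.2, Φ z.2⟫‖ ≤ ‖u z.1 z.2‖ * ‖Φ z.2‖ := norm_inner_le_norm _ _
      _ ≤ Kb * ‖Φ z.2‖ := mul_le_mul_of_nonneg_right (hz ⟨hzS.1, hxB⟩) (norm_nonneg _)
  · simp only [hΦs z.2 hx, inner_zero_right, norm_zero, mul_zero, le_refl]

/-- The remainder integrand `⟪u, DΦ u⟫ + ⟪u, ΔΦ⟫ + (p - c) div Φ` is integrable on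
`(0, T_b') × ℝ³` (velocity bounded on `(0,T_b') × B(x₀,7/12)`, gauged pressure integrable on
`(0,T_b') × B̄(x₀,7/24)`, `Φ` a `C²` field supported in `B̄(x₀, 7/24)`). [folklore] -/
theorem integrable_remainder_integrand {u : ℝ → (EuclideanSpace ℝ (Fin 3)) → (EuclideanSpace ℝ (Fin 3))}
    {q : ℝ → (EuclideanSpace ℝ (Fin 3)) → ℝ} {x₀ : EuclideanSpace ℝ (Fin 3)} {Tb' Kb : ℝ}
    (hum : AEStronglyMeasurable (uncurry u) (volume.restrict (Ioo 0 Tb' ×ˢ (univ : Set (EuclideanSpace ℝ (Fin 3))))))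
    (hbd : ∀ᵐ z ∂(volume.restrict (Ioo 0 Tb' ×ˢ ball x₀ (7 / 12))), ‖u z.1 z.2‖ ≤ Kb)
    (hqI : IntegrableOn (fun z : ℝ × EuclideanSpace ℝ (Fin 3) => q z.1 z.2) (Ioo 0 Tb' ×ˢ closedBall x₀ (7 / 24)) volume)
    {Φ : (EuclideanSpace ℝ (Fin 3)) → (EuclideanSpace ℝ (Fin 3))} (hΦ : ContDiff ℝ 2 Φ)
    (hΦs : tsupport Φ ⊆ closedBall x₀ (7 / 24)) :
    Integrable (fun z : ℝ × EuclideanSpace ℝ (Fin 3) =>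
        ⟪u z.1 z.2, fderiv ℝ Φ z.2 (u z.1 z.2)⟫ + ⟪u z.1 z.2, Δ Φ z.2⟫ + q z.1 z.2 * VectorCalculus.divergence Φ z.2)
      (((volume : Measure ℝ).restrict (Ioo 0 Tb')).prod (volume : Measure (EuclideanSpace ℝ (Fin 3)))) := by
  have hμ : ((volume : Measure ℝ).restrict (Ioo 0 Tb')).prod (volume : Measure (EuclideanSpace ℝ (Fin 3))) =
      volume.restrict (Ioo 0 Tb' ×ˢ (univ : Set (EuclideanSpace ℝ (Fin 3)))) := by
    rw [Measure.volume_eq_prod, ← Measure.prod_restrict, Measure.restrict_univ]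
  haveI : IsFiniteMeasure ((volume : Measure ℝ).restrict (Ioo 0 Tb')) := ⟨by
    rw [Measure.restrict_apply_univ]; exact measure_Ioo_lt_top⟩
  have hΦcs : HasCompactSupport Φ := HasCompactSupport.of_support_subset_isCompact (isCompact_closedBall x₀ (7 / 24))
    ((subset_tsupport Φ).trans hΦs)
  have hΦd : Differentiable ℝ Φ := hΦ.differentiable (by norm_num)
  have cD : Continuous (fderiv ℝ Φ) := hΦ.continuous_fderiv (by norm_num)
  have cL : Continuous (Δ Φ) := continuous_laplacian hΦ
  have hDcs : HasCompactSupport (fderiv ℝ Φ) := hΦcs.fderiv ℝ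
  have hLcs : HasCompactSupport (Δ Φ) := hasCompactSupport_laplacian' hΦcs
  -- zero sets
  have hD0 : ∀ x, x ∉ closedBall x₀ (7 / 24) → fderiv ℝ Φ x = 0 := fun x hx => by
    have h0 : Φ =ᶠ[𝓝 x] fun _ => (0 : EuclideanSpace ℝ (Fin 3)) := notMem_tsupport_iff_eventuallyEq.1 fun h => hx (hΦs h)
    rw [h0.fderiv_eq, fderiv_fun_const]; rfl
  have hL0 : ∀ x, x ∉ closedBall x₀ (7 / 24) → Δ Φ x = 0 := fun x hx =>
    laplacian_eq_zero_of_notMem_tsupport fun h => hx (hΦs h)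
  have hdiv0 : ∀ x, x ∉ closedBall x₀ (7 / 24) → VectorCalculus.divergence Φ x = 0 := fun x hx => by
    simp [VectorCalculus.divergence, hD0 x hx]
  obtain ⟨K₁, hK₁⟩ := cD.bounded_above_of_compact_support hDcs
  have hbd' : ∀ᵐ z ∂(volume : Measure (ℝ × EuclideanSpace ℝ (Fin 3))), z ∈ Ioo 0 Tb' ×ˢ ball x₀ (7 / 12) → ‖u z.1 z.2‖ ≤ Kb :=
    (ae_restrict_iff' (measurableSet_Ioo.prod measurableSet_ball)).1 hbd
  -- first piece
  have i1 : Integrable (fun z : ℝ × EuclideanSpace ℝ (Fin 3) => ⟪u z.1 z.2, fderiv ℝ Φ z.2 (u z.1 z.2)⟫)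
      (volume.restrict (Ioo 0 Tb' ×ˢ (univ : Set (EuclideanSpace ℝ (Fin 3))))) := by
    have hdom : Integrable (fun z : ℝ × EuclideanSpace ℝ (Fin 3) => Kb * Kb * ‖fderiv ℝ Φ z.2‖)
        (volume.restrict (Ioo 0 Tb' ×ˢ (univ : Set (EuclideanSpace ℝ (Fin 3))))) := by
      rw [← hμ]
      have h := (integrable_const (Kb * Kb)).mul_prod ((cD.integrable_of_hasCompactSupport (μ := volume) hDcs).norm)
        (μ := (volume : Measure ℝ).restrict (Ioo 0 Tb'))
      simpa using h
    have hm : AEStronglyMeasurable (fun z : ℝ × EuclideanSpace ℝ (Fin 3) => ⟪u z.1 z.2, fderiv ℝ Φ z.2 (u z.1 z.2)⟫)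
        (volume.restrict (Ioo 0 Tb' ×ˢ (univ : Set (EuclideanSpace ℝ (Fin 3))))) :=
      hum.inner (isBoundedBilinearMap_apply.continuous.comp_aestronglyMeasurable
        ((cD.comp continuous_snd).aestronglyMeasurable.prodMk hum))
    refine Integrable.mono' hdom hm ?_
    rw [ae_restrict_iff' (measurableSet_Ioo.prod MeasurableSet.univ)]
    filter_upwards [hbd'] with z hz hzS
    by_cases hx : z.2 ∈ closedBall x₀ (7 / 24)
    · have hxB : z.2 ∈ ball x₀ (7 / 12) := closedBall_subset_ball (by norm_num) hx
      have hu := hz ⟨hzS.1, hxB⟩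
      have hKb : 0 ≤ Kb := (norm_nonneg _).trans hu
      calc ‖⟪u z.1 z.2, fderiv ℝ Φ z.2 (u z.1 z.2)⟫‖ ≤ ‖u z.1 z.2‖ * ‖fderiv ℝ Φ z.2 (u z.1 z.2)‖ := norm_inner_le_norm _ _
        _ ≤ ‖u z.1 z.2‖ * (‖fderiv ℝ Φ z.2‖ * ‖u z.1 z.2‖) :=
            mul_le_mul_of_nonneg_left (ContinuousLinearMap.le_opNorm _ _) (norm_nonneg _)
        _ ≤ Kb * (‖fderiv ℝ Φ z.2‖ * Kb) := mul_le_mul hu (mul_le_mul_of_nonneg_left hu (norm_nonneg _)) (by positivity) hKb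
        _ = Kb * Kb * ‖fderiv ℝ Φ z.2‖ := by ring
    · simp [hD0 z.2 hx]
  -- second piece
  have i2 : Integrable (fun z : ℝ × EuclideanSpace ℝ (Fin 3) => ⟪u z.1 z.2, Δ Φ z.2⟫)
      (volume.restrict (Ioo 0 Tb' ×ˢ (univ : Set (EuclideanSpace ℝ (Fin 3))))) := by
    have h := integrable_pairing_integrand hum hbd cL hL0
    rwa [hμ] at h
  -- third piece
  have i3 : Integrable (fun z : ℝ × EuclideanSpace ℝ (Fin 3) => q z.1 z.2 * VectorCalculus.divergence Φ z.2)
      (volume.restrict (Ioo 0 Tb' ×ˢ (univ : Set (EuclideanSpace ℝ (Fin 3))))) := by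
    have hdivc : Continuous (VectorCalculus.divergence Φ) := continuous_divergence cD
    have hdivb : ∀ x, ‖VectorCalculus.divergence Φ x‖ ≤ 3 * K₁ := fun x => by
      rw [Real.norm_eq_abs]; exact norm_divergence_le_three_mul hK₁ x
    have h1 : IntegrableOn (fun z : ℝ × EuclideanSpace ℝ (Fin 3) => q z.1 z.2 * VectorCalculus.divergence Φ z.2)
        (Ioo 0 Tb' ×ˢ closedBall x₀ (7 / 24)) volume := by
      have : (fun z : ℝ × EuclideanSpace ℝ (Fin 3) => q z.1 z.2 * VectorCalculus.divergence Φ z.2) =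
          fun z => VectorCalculus.divergence Φ z.2 * q z.1 z.2 := by funext z; ring
      rw [this]
      exact hqI.bdd_mul (hdivc.comp continuous_snd).aestronglyMeasurable (Eventually.of_forall fun z => hdivb z.2)
    refine h1.of_forall_sdiff_eq_zero (measurableSet_Ioo.prod MeasurableSet.univ) ?_
    rintro z ⟨hzS, hz⟩
    have hx : z.2 ∉ closedBall x₀ (7 / 24) := fun h => hz ⟨hzS.1, h⟩
    simp only [hdiv0 z.2 hx, mul_zero]
  rw [hμ]
  exact (i1.add i2).add i3

set_option maxHeartbeats 1600000 in
/-- **The pairings of the solution with spatial test fields are primitives, with the datum as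
initial value.** Let `(u, p)` be a local Leray solution on `(0,T') × ℝ³` with measurable datum
`u₀`, `0 < T_b' ≤ T'`, `|u| ≤ K_b` a.e. on `(0,T_b') × B(x₀, 7/12)`, and `c ∈ L^{3/2}(0,T')` a
gauge with `p - c` integrable on `(0,T_b') × B̄(x₀, 7/24)`. Then for every test field `Φ` on
`B(x₀, 7/24)`, for a.e. `t ∈ (0, T_b')`,
`∫ ⟪u(t), Φ⟫ = ∫ ⟪u₀, Φ⟫ + ∫_{(0,t]} ∫ (⟪u, DΦ u⟫ + ⟪u, ΔΦ⟫ + (p - c) div Φ)(s) ds`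
(weak form with datum tested by `η(t)Φ(x)`, and du Bois-Reymond's lemma with datum).
[cite: RobinsonRodrigoSadowski2016, §3.1 (3.1)] [cite: Brezis2011, Lemma 8.1] -/
theorem pairing_primitive {T' : ℝ} {x₀ : EuclideanSpace ℝ (Fin 3)}
    {u₀ : (EuclideanSpace ℝ (Fin 3)) → (EuclideanSpace ℝ (Fin 3))}
    {u : ℝ → (EuclideanSpace ℝ (Fin 3)) → (EuclideanSpace ℝ (Fin 3))} {p : ℝ → (EuclideanSpace ℝ (Fin 3)) → ℝ}
    {Tb' Kb : ℝ} (hm₀ : AEStronglyMeasurable u₀ volume) (hu : IsLocalLeraySolutionOn T' 1 u₀ u p)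
    (hTb' : 0 < Tb') (hTb'T' : Tb' ≤ T')
    (hbd : ∀ᵐ z ∂(volume.restrict (Ioo 0 Tb' ×ˢ ball x₀ (7 / 12))), ‖u z.1 z.2‖ ≤ Kb)
    {cg : ℝ → ℝ} (hcg : MemLp cg (3 / 2 : ℝ≥0∞) (volume.restrict (Ioo 0 T')))
    (hpI : IntegrableOn (fun z : ℝ × EuclideanSpace ℝ (Fin 3) => p z.1 z.2 - cg z.1) (Ioo 0 Tb' ×ˢ closedBall x₀ (7 / 24)) volume)
    {Φ : (EuclideanSpace ℝ (Fin 3)) → (EuclideanSpace ℝ (Fin 3))}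
    (hΦ : FunctionSpaces.IsTestFunctionOn (⟨ball x₀ (7 / 24), isOpen_ball⟩ : Opens (EuclideanSpace ℝ (Fin 3))) Φ) :
    ∀ᵐ t ∂(volume.restrict (Ioo 0 Tb')),
      (∫ x, ⟪u t x, Φ x⟫) = (∫ x, ⟪u₀ x, Φ x⟫) +
        ∫ s in Ioc 0 t, ∫ x, (⟪u s x, fderiv ℝ Φ x (u s x)⟫ + ⟪u s x, Δ Φ x⟫ +
          (p s x - cg s) * VectorCalculus.divergence Φ x) := by
  have hu'' : IsLocalLeraySolutionOn Tb' 1 u₀ u p := hu.mono hTb'T'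
  have hum : AEStronglyMeasurable (uncurry u) (volume.restrict (Ioo 0 Tb' ×ˢ (univ : Set (EuclideanSpace ℝ (Fin 3))))) :=
    hu''.aestronglyMeasurable
  have hμ : ((volume : Measure ℝ).restrict (Ioo 0 Tb')).prod (volume : Measure (EuclideanSpace ℝ (Fin 3))) =
      volume.restrict (Ioo 0 Tb' ×ˢ (univ : Set (EuclideanSpace ℝ (Fin 3)))) := by
    rw [Measure.volume_eq_prod, ← Measure.prod_restrict, Measure.restrict_univ]
  have hΦs : tsupport Φ ⊆ closedBall x₀ (7 / 24) := hΦ.tsupport_subset.trans ball_subset_closedBall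
  have hΦ0 : ∀ x, x ∉ closedBall x₀ (7 / 24) → Φ x = 0 := fun x hx => image_eq_zero_of_notMem_tsupport fun h => hx (hΦs h)
  have hΦ2 : ContDiff ℝ 2 Φ := hΦ.contDiff.of_le (by norm_cast)
  have hΦd : Differentiable ℝ Φ := hΦ.contDiff.differentiable (by simp)
  -- the two integrands and their integrability
  set FU : ℝ × EuclideanSpace ℝ (Fin 3) → ℝ := fun z => ⟪u z.1 z.2, Φ z.2⟫ with hFU
  set FG : ℝ × EuclideanSpace ℝ (Fin 3) → ℝ := fun z =>
    ⟪u z.1 z.2, fderiv ℝ Φ z.2 (u z.1 z.2)⟫ + ⟪u z.1 z.2, Δ Φ z.2⟫ + (p z.1 z.2 - cg z.1) * VectorCalculus.divergence Φ z.2 with hFG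
  have iU : Integrable FU (((volume : Measure ℝ).restrict (Ioo 0 Tb')).prod (volume : Measure (EuclideanSpace ℝ (Fin 3)))) :=
    integrable_pairing_integrand hum hbd hΦ.contDiff.continuous hΦ0
  have iG : Integrable FG (((volume : Measure ℝ).restrict (Ioo 0 Tb')).prod (volume : Measure (EuclideanSpace ℝ (Fin 3)))) :=
    integrable_remainder_integrand (q := fun s x => p s x - cg s) hum hbd hpI hΦ2 hΦs
  set g : ℝ → ℝ := fun t => ∫ x, FU (t, x) with hg
  set f : ℝ → ℝ := fun t => ∫ x, FG (t, x) with hf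
  have hgI : IntegrableOn g (Ioo 0 Tb') := iU.integral_prod_left
  have hfI : IntegrableOn f (Ioo 0 Tb') := iG.integral_prod_left
  -- the weak identity tested with `η(t) Φ(x)`
  have hkey : ∀ η : ℝ → ℝ, ContDiff ℝ ∞ η → HasCompactSupport η → tsupport η ⊆ Iio Tb' →
      (∫ s in Ioo 0 Tb', (deriv η s * g s + η s * f s)) + η 0 * ∫ x, ⟪u₀ x, Φ x⟫ = 0 := by
    intro η hη hηc hηI
    have hηd : Differentiable ℝ η := hη.differentiable (by simp)
    have hΦuniv : FunctionSpaces.IsTestFunctionOn (⟨(univ : Set (EuclideanSpace ℝ (Fin 3))), isOpen_univ⟩ :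
        Opens (EuclideanSpace ℝ (Fin 3))) Φ :=
      ⟨hΦ.contDiff, hΦ.hasCompactSupport, subset_univ _⟩
    have hψ : IsSpaceTimeTestOn (slab (EuclideanSpace ℝ (Fin 3)) (Iio Tb') isOpen_Iio) (fun s x => η s • Φ x) :=
      isSpaceTimeTestOn_prod_smul isOpen_Iio isOpen_univ hη hηc hηI hΦuniv
    have key := hu.weakIdentity_datum_gauge hm₀ hTb' hTb'T' hcg hψ
    -- rewrite the integrand pointwise
    have hpt : ∀ s x, ⟪u s x, timeDeriv (fun s x => η s • Φ x) s x⟫ + ⟪u s x, convect (u s) (fun x => η s • Φ x) x⟫ +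
        1 * ⟪u s x, Δ (fun x => η s • Φ x) x⟫ + (p s x - cg s) * VectorCalculus.divergence (fun x => η s • Φ x) x =
        deriv η s * FU (s, x) + η s * FG (s, x) := by
      intro s x
      rw [timeDeriv_prod_smul hηd, convect_fun_const_smul _ (hΦd x), laplacian_fun_const_smul hΦ2, divergence_fun_const_smul (hΦd x)]
      simp only [hFU, hFG, inner_smul_right, one_mul, convect]
      ring
    have hinner : ∀ᵐ s ∂(volume.restrict (Ioo 0 Tb')),
        (∫ x, (⟪u s x, timeDeriv (fun s x => η s • Φ x) s x⟫ + ⟪u s x, convect (u s) (fun x => η s • Φ x) x⟫ +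
          1 * ⟪u s x, Δ (fun x => η s • Φ x) x⟫ + (p s x - cg s) * VectorCalculus.divergence (fun x => η s • Φ x) x)) =
        deriv η s * g s + η s * f s := by
      filter_upwards [iU.prod_right_ae, iG.prod_right_ae] with s h1 h2
      simp_rw [hpt]
      rw [integral_add (h1.const_mul _) (h2.const_mul _), MeasureTheory.integral_const_mul, MeasureTheory.integral_const_mul]
    rw [integral_congr_ae hinner] at key
    have hdatum : ∫ x, ⟪u₀ x, (fun s x => η s • Φ x) 0 x⟫ = η 0 * ∫ x, ⟪u₀ x, Φ x⟫ := by
      simp only [inner_smul_right]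
      exact MeasureTheory.integral_const_mul _ _
    rw [hdatum] at key
    exact key
  -- du Bois-Reymond with datum
  have h := FunctionSpaces.ae_eq_add_setIntegral_of_forall_test hgI hfI hkey
  filter_upwards [h] with t ht
  exact ht

end JiaSverak2014

end Literature.Analysis.FluidPDE
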